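import Summits.CriticalPhenomena.CardyFormulaZ2.Theses.CardySusyWard

/-!
# Crux-triage r1-1, crux `CardySusyWard.WeakHolomorphy` (stmt-CriticalPhenomena-11292): sharpened target, v2

**v2 — RETRACTION of v1 (2026-08-16T00:39Z).** v1 typed `SublatticeCoherence` / `StaggeredAntiHolomorphy`
over the TREE's vertex observable `MedialPath.passageSum` (bisector winding). As the cdisprove seat proved
(`Cruxes/WeakHolomorphy/Disproof.lean` §C, `bisector_stagger_telescope`, `stagger_sum_bound`;
`StaggeredBisectorVacuous.md`), the sublattice-staggered pairing of the BISECTOR observable telescopes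
pathwise and is `O(δ^{2/3})` with no percolation input, so those v1 statements were TRUE FOR TRIVIAL REASONS
and `CoherenceClosesWeakHolomorphy` (v1) was the whole crux in disguise. The slip in TRIAGE-r1-1 v1 §2
("any vertex convention"): `F^{bis} = F^{ent}/cos(π/12) − 2 sin(π/12)·K` is exact, but the telescoping of
`Σ_z ψ(z) K_z` needs a SMOOTH weight; against the staggered weight `s_z ψ` it returns `2 Σ_z s_z ψ F^{ent}`
and, with `4 sin(π/12) cos(π/12) = 1`, the staggered bisector pairing cancels identically at leading order.

The contentful statements are the ENTRY-convention ones below (arrival winding, no half turn), equivalently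
the `A₂` Fourier mode of the dart classes (`Theorems/CoherentMorera/Negative/KirchhoffModes`, `A2`;
`Disproof.lean` §D `StaggeredEntryAntiHolomorphy` / `A2ModeVanishes`, which this file deliberately mirrors
rather than re-invents):

* `SublatticeCoherenceEntry` — `δ^{5/3} Σ_z s_z F^{ent}_δ(z) ψ(z_δ) → 0` for every test function `ψ`:
  the `A₂` mode (sublattice-staggered Kirchhoff mode) is weakly `o(δ^{1/3})`. STRONGER than the crux.
* `StaggeredEntryAntiHolomorphy'` — the same tested only against `ψ = ∂φ`; given the exact vertex relation
  (DC2012 Prop. 4, `Disproof.VertexRelationExact`, owed in the tree) this is EQUIVALENT to `WeakHolomorphy`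
  by the summation-by-parts identity (‡) (TRIAGE-r1-1 §2 = Disproof §D steps 2–5).

Numerically (this seat's MC, dart/entry phases: kit j014311, j014454, j014485–j014490): the `A₂` pairing is
`≤ 1e-3` of the `A₀` pairing at `L = 16, 32` while the `A₁/A₃` ("opposite-dart") staggering is `≈ 0.3·(16/L)^{1/4}`.
No proof is claimed here.
-/

namespace Summit.CriticalPhenomena.CardyFormulaZ2.Cruxes.WeakHolomorphy.Triage

open Literature.Probability.LatticeModels

/-- Medial-sublattice sign of a medial vertex of `ℤ²`: `+1` for a horizontal lattice edge `{x, x+e₀}`,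
`−1` for a vertical one `{x, x+e₁}`, `0` for a non-edge pair. -/
noncomputable def sublatticeSign (z : MedialVertex) : ℂ := by
  classical
  exact if ∃ x : Site 2, z = s(x, x + Pi.single 0 1) then 1
    else if ∃ x : Site 2, z = s(x, x + Pi.single 1 1) then -1 else 0

/-- ENTRY-convention passage sum (arrival winding: `Polyline.winding` of the prefix ENDING at the passage,
no half-turn) — verbatim the shape of `Disproof.entryPassageSum`. -/
noncomputable def entryPassageSum (γ : List MedialVertex) (δ σ : ℝ) (z : MedialVertex) : ℂ :=
  ∑ k ∈ (Finset.range γ.length).filter (fun k => γ[k]? = some z),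
    Complex.exp (-Complex.I * σ * (Polyline.winding ((γ.map (medialPoint δ)).take (k + 1)) : ℝ))

/-- The q = 1, spin-1/3 ENTRY-convention vertex observable of the family `Λ` at mesh `δ`. -/
noncomputable def FobsEntry (Λ : ℝ → DiscreteDobrushin) (δ : ℝ) (z : MedialVertex) : ℂ :=
  ∫ ω, entryPassageSum (medialExploration (Λ δ) ω) δ (1 / 3) z
    ∂(Literature.Probability.Percolation.bondPercolation (zdGraph 2) Literature.Probability.Percolation.half)

/-- The six discretisation-family hypotheses of `WeakHolomorphy`, bundled. -/
def IsAdmissibleFamily (D : Literature.Probability.RandomPlanarGeometry.DobrushinDomain)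
    (Λ : ℝ → DiscreteDobrushin) : Prop :=
  (∀ δ, (Λ δ).Ω = D.carrier) ∧ (∀ δ, (Λ δ).δ = δ) ∧
  Filter.Tendsto (fun δ : ℝ => Metric.hausdorffEDist (Λ δ).arcA (D.arc 0)) (nhdsWithin (0:ℝ) (Set.Ioi 0)) (nhds 0) ∧
  Filter.Tendsto (fun δ : ℝ => Metric.hausdorffEDist (Λ δ).arcB (D.arc 1)) (nhdsWithin (0:ℝ) (Set.Ioi 0)) (nhds 0) ∧
  Filter.Tendsto (fun δ : ℝ => Metric.hausdorffEDist (medialPoint δ '' (Λ δ).zdABEdges) {D.pt 0, D.pt 1})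
    (nhdsWithin (0:ℝ) (Set.Ioi 0)) (nhds 0) ∧
  (∀ᶠ δ in nhdsWithin (0:ℝ) (Set.Ioi 0), (Λ δ).IsZdAdmissible)

/-- **T\* (sublattice coherence = vanishing `A₂` mode, weak form at scale δ^{1/3}, ENTRY convention).**
Stronger than the crux (which needs only its `ψ = ∂φ` instances). -/
def SublatticeCoherenceEntry : Prop :=
  ∀ (D : Literature.Probability.RandomPlanarGeometry.DobrushinDomain) (Λ : ℝ → DiscreteDobrushin),
    IsAdmissibleFamily D Λ → ∀ (ψ : ℂ → ℂ), ContDiff ℝ (⊤ : ℕ∞) ψ → HasCompactSupport ψ → tsupport ψ ⊆ D.carrier →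
      Filter.Tendsto (fun δ : ℝ => ((δ ^ ((5:ℝ) / 3) : ℝ) : ℂ) *
        ∑ᶠ z : MedialVertex, sublatticeSign z * FobsEntry Λ δ z * ψ (medialPoint δ z))
        (nhdsWithin 0 (Set.Ioi 0)) (nhds 0)

/-- **Staggered entry anti-holomorphy** (`ψ := ∂φ = (∂ₓφ − i∂_yφ)/2`): given the exact vertex relation this
is EQUIVALENT to `WeakHolomorphy` (Disproof §D, `weakHolomorphy_iff_staggeredEntry_of_vertexRelation`). -/
def StaggeredEntryAntiHolomorphy' : Prop :=
  ∀ (D : Literature.Probability.RandomPlanarGeometry.DobrushinDomain) (Λ : ℝ → DiscreteDobrushin),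
    IsAdmissibleFamily D Λ → ∀ (φ : ℂ → ℂ), ContDiff ℝ (⊤ : ℕ∞) φ → HasCompactSupport φ → tsupport φ ⊆ D.carrier →
      Filter.Tendsto (fun δ : ℝ => ((δ ^ ((5:ℝ) / 3) : ℝ) : ℂ) *
        ∑ᶠ z : MedialVertex, sublatticeSign z * FobsEntry Λ δ z *
          ((fderiv ℝ φ (medialPoint δ z) 1 - Complex.I * fderiv ℝ φ (medialPoint δ z) Complex.I) / 2))
        (nhdsWithin 0 (Set.Ioi 0)) (nhds 0)

/-- Stub proposal (contentful, ENTRY convention): coherence closes the crux. Its proof is (‡) plus the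
bookkeeping listed in `Disproof.weakHolomorphy_iff_staggeredEntry_of_vertexRelation`, plus DC2012 Prop. 4. -/
def CoherenceEntryClosesWeakHolomorphy : Prop :=
  SublatticeCoherenceEntry → Summit.CriticalPhenomena.CardyFormulaZ2.Theses.CardySusyWard.WeakHolomorphy

/-- Trivial direction, for orientation only: the `∂φ`-instances of coherence are among its `ψ`-instances
(modulo `∂φ` being again a test function, where a proof would start). -/
example : CoherenceEntryClosesWeakHolomorphy =
    (SublatticeCoherenceEntry → Summit.CriticalPhenomena.CardyFormulaZ2.Theses.CardySusyWard.WeakHolomorphy) := rfl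

end Summit.CriticalPhenomena.CardyFormulaZ2.Cruxes.WeakHolomorphy.Triage
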